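import Summits.AtomisticToContinuum.HydrodynamicLimit.Theses.SinaiSteeringDichotomy

/-!
# Birth skeleton — `InBandActiveEnergyClosureCost` (stmt-AtomisticToContinuum-18766; piece X₁ of the
strategist split D1 of `ActiveEnergyClosureCost` stmt-9506, route SinaiSteeringDichotomy)

The crux: under the invariant homogeneous hard-sphere Gibbs law `G_N = localGibbsLaw σ 1 0 θe N`, for every
smooth test `φ` on `[s,s+τ]` and `δ > 0` there are `(α, κ)` such that for every `M`, eventually in `N`,
`G_N{ speed cap (N+1)^(1/24) ∧ ball-packing cap η₁ ∧ δ < |D^E_N| ∧ ¬Deficit_(α,κ) } ≤ exp(−M(N+1))`,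
`D^E_N` the time-integrated weak-form ENERGY closure defect of the ball fields, `Deficit` the crux's
mass-weighted relative collision deficit.

## The line — kinetic / collisional split of the energy current (the sub's standard seam, cf.
`Cruxes/EnergyClosureCost/Lines/birth.lean` for stmt-14426), carried INSIDE the active/in-band event

Along a hard-sphere orbit the raw energy functional `Et(r)(φ(r))` changes by FREE STREAMING — at rate the
microscopic kinetic energy current `K_N(r) = (N+1)⁻¹ Σ_i ½|v_i|² v_i·∇φ(r,q_i)` — and by COLLISIONAL TRANSFER
across contacts. Accordingly `D = (D − D_kin) + D_kin` with
`D_kin = kineticDefect = ∫_s^(s+τ) [K_N(r) − ∫ (e + ρθ)(m/ρ)·∇φ dx] dr` (ideal enthalpy flux of the ball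
fields, `θ = ⅔(e/ρ − |m|²/(2ρ²))`) and `D − D_kin` = collisional transfer minus the excess-pressure work
`(p − ρθ)(m/ρ)·∇φ`.

* `stub_activeKineticClosure` (A, hardest): the ACTIVE, IN-BAND cost of `δ < |D_kin|` — same prefix, law,
  caps and Deficit predicate as the crux. The route's engine (B1±-upper + martingale window LD along the
  collision filtration, for the CUBIC current) is claimed exactly here; the crux's why-might-fail (tenuous hot
  collisionless sheets in a shielded evacuated slab, not mass-deficient, cost `N·τ√(2θ log N)` by the route's
  tail-regeneration margin vs `≈ 2.3N` by refuter rreview1 on stmt-14424) bites exactly this stub.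
* `stub_activeCollisionalClosure` (B): the ACTIVE, IN-BAND cost of `δ < |D − D_kin|` — local virial =
  equation of state (`hsPressure`) at ball scale plus collision-count entropy for a sustained transfer bias;
  in-band the contact textures are those of a dilute FLUID (the strained-crystal witness of REVIEW.md F1 is
  out of band by construction).
* `InBandActiveEnergyClosureCost_of`: `η₁ := min`, `σ₀ := min`, both stubs at `δ/2` and `M+1`,
  `(α,κ) := (min, min)` (the Deficit predicate is antitone: `deficitPred_mono`, `pred ≥ 0`), monotonicity of
  the packing cap in `η₁`, `|D| > δ ⇒ |D − D_kin| > δ/2 ∨ |D_kin| > δ/2`, union bound,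
  `2e^(−(M+1)(N+1)) ≤ e^(−M(N+1))`; the crux's `let`-bound event is this file's
  `SpeedCap ∧ PackingCap ∧ δ < |energyDefect| ∧ ¬ deficitPred` by `δ/ζ`-unfolding (`change`).

Disproof used: no `Disproof.lean` exists for stmt-18766 / stmt-9506 (2026-08-17). The parent's standing
witness (REVIEW.md F1, strained-crystal inclusion) is OUT of band — it is the sibling piece X₂'s content, not a
constraint on these stubs. `ledger negatives --problem AtomisticToContinuum` (20 entries): none is an instance
of either stub (finite-instance Enskog / warm–cold cell statements; these are `N → ∞` LD statements).
Sources: KipnisLandim1999 Ch. 10 Thm 3.1 (superexponential replacement template); Spohn1991 Part I Ch. 3,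
(3.7), §7; ChernovDolgopyat2009 (standard pairs); doi:10.1007/s00220-012-1596-7 (concentration for
hyperbolic flows); OllaVaradhanYau1993 §1.
-/

namespace Summit.AtomisticToContinuum.HydrodynamicLimit.Cruxes.ActiveEnergyClosureCost.InBandBirth

open scoped BigOperators ENNReal
open MeasureTheory Filter Set
open Literature.MathematicalPhysics.KineticTheory

noncomputable section

/-- The hard-sphere flow type of the route: `N + 1` spheres of diameter `hsDiameter σ N` on `𝕋³`. -/
abbrev Flow (σ : ℝ) (N : ℕ) :=
  Literature.Analysis.FluidPDE.HardSphereFlow (Literature.Analysis.FluidPDE.Torus.geometry (Fin 3))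
    (hsDiameter σ N) (N + 1)

/-- Local alias of the crux (the target decl, BY NAME) — so that exactly ONE theorem of this file has the crux as its
syntactic head (`ledger skeleton check` takes the first crux-headed theorem as the skeleton). -/
def CruxStatement : Prop :=
  Summit.AtomisticToContinuum.HydrodynamicLimit.Theses.SinaiSteeringDichotomy.InBandActiveEnergyClosureCost

theorem cruxStatement_iff : CruxStatement ↔ Summit.AtomisticToContinuum.HydrodynamicLimit.Theses.SinaiSteeringDichotomy.InBandActiveEnergyClosureCost := Iff.rfl

/-- SPEED CAP of the conditioning event (verbatim the crux's first conjunct). -/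
def SpeedCap (σ : ℝ) (N : ℕ) (Φ : Flow σ N) (s τ : ℝ)
    (z : Literature.Analysis.FluidPDE.Config (N + 1) (Fin 3) T3) : Prop :=
  ∀ r ∈ Set.Icc s (s + τ), ∀ i, ‖(Φ.flow r z i).2‖ ≤ ((N + 1 : ℕ) : ℝ) ^ (1 / 24 : ℝ)

/-- PACKING CAP of the conditioning event (verbatim the crux's second conjunct): every ball of radius
`ℓ_N = (N+1)^(-1/4)` has empirical packing `ρ^(ℓ) σ³ ≤ η₁` on `[s, s+τ]`. -/
def PackingCap (σ η₁ : ℝ) (N : ℕ) (Φ : Flow σ N) (s τ : ℝ)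
    (z : Literature.Analysis.FluidPDE.Config (N + 1) (Fin 3) T3) : Prop :=
  ∀ r ∈ Set.Icc s (s + τ), ∀ x : T3,
    empiricalDensityField (Φ.flow r z)
        (fun y => if Literature.Analysis.FluidPDE.Torus.euclidDist x y < ((N + 1 : ℕ) : ℝ) ^ (-(1 / 4 : ℝ))
          then (4 / 3 * Real.pi * (((N + 1 : ℕ) : ℝ) ^ (-(1 / 4 : ℝ))) ^ 3)⁻¹ else 0) * σ ^ 3 ≤ η₁

/-- The crux's time-integrated weak-form ENERGY closure defect `D^E_N(z)` — verbatim the quantity inside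
`δ < |…|` of the crux. -/
def energyDefect (σ : ℝ) (N : ℕ) (Φ : Flow σ N) (s τ : ℝ) (φ : ℝ → T3 → ℝ)
    (z : Literature.Analysis.FluidPDE.Config (N + 1) (Fin 3) T3) : ℝ :=
  let ℓ : ℝ := ((N + 1 : ℕ) : ℝ) ^ (-(1 / 4 : ℝ)); let χ : Literature.MathematicalPhysics.KineticTheory.T3 → Literature.MathematicalPhysics.KineticTheory.T3 → ℝ := fun x y => if Literature.Analysis.FluidPDE.Torus.euclidDist x y < ℓ then (4 / 3 * Real.pi * ℓ ^ 3)⁻¹ else 0; let ρ : ℝ → Literature.MathematicalPhysics.KineticTheory.T3 → ℝ := fun r x => Literature.MathematicalPhysics.KineticTheory.empiricalDensityField (Φ.flow r z) (χ x); let m : ℝ → Literature.MathematicalPhysics.KineticTheory.T3 → Literature.MathematicalPhysics.KineticTheory.V3 := fun r x => Literature.MathematicalPhysics.KineticTheory.empiricalMomentumField (Φ.flow r z) (χ x); let e : ℝ → Literature.MathematicalPhysics.KineticTheory.T3 → ℝ := fun r x => Literature.MathematicalPhysics.KineticTheory.empiricalEnergyField (Φ.flow r z) (χ x); let p : ℝ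 → Literature.MathematicalPhysics.KineticTheory.T3 → ℝ := fun r x => Literature.MathematicalPhysics.KineticTheory.hsPressure σ (ρ r x) (2 / 3 * (e r x / ρ r x - ‖m r x‖ ^ 2 / (2 * ρ r x ^ 2))); let Et : ℝ → (Literature.MathematicalPhysics.KineticTheory.T3 → ℝ) → ℝ := fun r g => Literature.MathematicalPhysics.KineticTheory.empiricalEnergyField (Φ.flow r z) g; Et (s + τ) (φ (s + τ)) - Et s (φ s) - ∫ r in s..(s + τ), (Et r (Literature.Analysis.FunctionSpaces.Torus.timeDerivWithin (Set.Icc s (s + τ)) φ r) + ∫ x, (e r x + p r x) * (∑ i, (m r x i / ρ r x) * (Literature.Analysis.FunctionSpaces.Torus.gradient (φ r) x) i))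

/-- The crux's mass-weighted relative collision-DEFICIT predicate `Deficit_(α,κ)(z)` — verbatim the `let`-block
negated in the crux's last conjunct. -/
def deficitPred (σ : ℝ) (N : ℕ) (Φ : Flow σ N) (s τ α κ : ℝ)
    (z : Literature.Analysis.FluidPDE.Config (N + 1) (Fin 3) T3) : Prop :=
  let ℓ : ℝ := ((N + 1 : ℕ) : ℝ) ^ (-(1 / 4 : ℝ)); let χ : Literature.MathematicalPhysics.KineticTheory.T3 → Literature.MathematicalPhysics.KineticTheory.T3 → ℝ := fun x y => if Literature.Analysis.FluidPDE.Torus.euclidDist x y < ℓ then (4 / 3 * Real.pi * ℓ ^ 3)⁻¹ else 0; let ρ := fun r x => Literature.MathematicalPhysics.KineticTheory.empiricalDensityField (Φ.flow r z) (χ x); let θ := fun r x => 2 / 3 * (Literature.MathematicalPhysics.KineticTheory.empiricalEnergyField (Φ.flow r z) (χ x) / ρ r x - ‖Literature.MathematicalPhysics.KineticTheory.empiricalMomentumField (Φ.flow r z) (χ x)‖ ^ 2 / (2 * ρ r x ^ 2)); let cnt := fun x => Set.ncard {r : ℝ | r ∈ Set.Icc s (s + τ) ∧ ∃ i j : Fin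 (N + 1), i ≠ j ∧ Φ.flow r z ∈ Literature.Analysis.FluidPDE.contactSet (Literature.Analysis.FluidPDE.Torus.geometry (Fin 3)) (N + 1) (Literature.MathematicalPhysics.KineticTheory.hsDiameter σ N) i j ∧ Literature.Analysis.FluidPDE.Torus.euclidDist (Φ.flow r z i).1 x < ℓ}; let pred := fun x => 8 / 3 * Real.pi ^ (3 / 2 : ℝ) * σ ^ 2 * ((N + 1 : ℕ) : ℝ) ^ (4 / 3 : ℝ) * ℓ ^ 3 * ∫ r in s..(s + τ), ρ r x ^ 2 * Real.sqrt (θ r x); ENNReal.ofReal α ≤ ∫⁻ x in {x : Literature.MathematicalPhysics.KineticTheory.T3 | (cnt x : ℝ) ≤ (1 - κ) * pred x}, ENNReal.ofReal (τ⁻¹ * ∫ r in s..(s + τ), ρ r x)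

/-- The KINETIC closure defect `D^K_N(z) = ∫_s^(s+τ) [K_N(r) − F_kin(r)] dr`: microscopic kinetic energy
current `K_N(r) = ∫ ½‖v‖² (v·∇φ(r,q)) dμ^emp` minus the IDEAL enthalpy flux of the ball fields
`F_kin(r) = ∫ (e + ρθ)(m/ρ)·∇φ dx`, `θ = ⅔(e/ρ − ‖m‖²/(2ρ²))`. -/
def kineticDefect (σ : ℝ) (N : ℕ) (Φ : Flow σ N) (s τ : ℝ) (φ : ℝ → T3 → ℝ)
    (z : Literature.Analysis.FluidPDE.Config (N + 1) (Fin 3) T3) : ℝ :=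
  let ℓ : ℝ := ((N + 1 : ℕ) : ℝ) ^ (-(1 / 4 : ℝ))
  let χ : T3 → T3 → ℝ := fun x y =>
    if Literature.Analysis.FluidPDE.Torus.euclidDist x y < ℓ then (4 / 3 * Real.pi * ℓ ^ 3)⁻¹ else 0
  let ρ : ℝ → T3 → ℝ := fun r x => empiricalDensityField (Φ.flow r z) (χ x)
  let m : ℝ → T3 → V3 := fun r x => empiricalMomentumField (Φ.flow r z) (χ x)
  let e : ℝ → T3 → ℝ := fun r x => empiricalEnergyField (Φ.flow r z) (χ x)
  let K : ℝ → ℝ := fun r =>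
    ∫ y, (‖y.2‖ ^ 2 / 2) * (∑ i, y.2 i * (Literature.Analysis.FunctionSpaces.Torus.gradient (φ r) y.1) i)
      ∂(Literature.Analysis.FluidPDE.empiricalMeasure (Φ.flow r z))
  let Fkin : ℝ → ℝ := fun r =>
    ∫ x, (e r x + ρ r x * (2 / 3 * (e r x / ρ r x - ‖m r x‖ ^ 2 / (2 * ρ r x ^ 2)))) *
      (∑ i, (m r x i / ρ r x) * (Literature.Analysis.FunctionSpaces.Torus.gradient (φ r) x) i)
  ∫ r in s..(s + τ), (K r - Fkin r)

/-! ### Registered stubs -/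

/-- **stub A — ACTIVE in-band kinetic energy-current closure (hardest).** For every smooth `φ`, `δ > 0`
there are `(α,κ)` such that for every `M`, eventually
`G_N {speed cap ∧ packing cap η₁ ∧ δ < |kineticDefect| ∧ ¬Deficit_(α,κ)} ≤ exp (−M(N+1))`: while all but a
mass fraction `< α` of the gas collides at `≥ (1−κ)` of its own Boltzmann rate and every ball is a dilute fluid,
a sustained mismatch between the microscopic kinetic energy current `½Σ‖v‖²v·∇φ` and the ideal enthalpy flux
`(e + ρθ)u·∇φ` costs `e^(−c n N)`, `n ≍ σ²N^(1/3)τ` collisions per particle (two-sided-fresh impact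
parameters ⇒ bounded martingale differences along the collision filtration; Azuma/Freedman).
Why it might fail: tenuous HOT collisionless sheets (mass `≍ N^(-1/12)`, speeds `≤ (N+1)^(1/24)`) in a shielded
evacuated slab are neither out of band nor mass-deficient and transport an `O(1)` anomalous energy flux; the
line lives iff shielding them against the bulk's regenerated Maxwellian tail costs `≫ N` (route: margin
`τ√(2θ log N)` ⇒ cost `≍ N√(log N)`; refuter rreview1 on stmt-14424: `≈ 2.3 N`). -/
theorem stub_activeKineticClosure :
    ∃ η₁ : ℝ, 0 < η₁ ∧ ∃ σ₀ : ℝ, 0 < σ₀ ∧ ∀ σ : ℝ, 0 < σ → σ < σ₀ → ∀ θe : ℝ, 0 < θe →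
      ∀ Φ : (N : ℕ) → Flow σ N, ∀ (s τ : ℝ), 0 ≤ s → 0 < τ → ∀ φ : ℝ → T3 → ℝ,
        Literature.Analysis.FunctionSpaces.Torus.IsSmoothSpaceTimeOn (Set.Icc s (s + τ)) φ →
          ∀ δ : ℝ, 0 < δ → ∃ α κ : ℝ, 0 < α ∧ 0 < κ ∧ κ < 1 ∧ ∀ M : ℝ, ∀ᶠ N : ℕ in Filter.atTop,
            localGibbsLaw σ (fun _ => 1) (fun _ => 0) (fun _ => θe) N (Φ N)
                {z | SpeedCap σ N (Φ N) s τ z ∧ PackingCap σ η₁ N (Φ N) s τ z ∧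
                  δ < |kineticDefect σ N (Φ N) s τ φ z| ∧ ¬ deficitPred σ N (Φ N) s τ α κ z}
              ≤ ENNReal.ofReal (Real.exp (-(M * (N + 1)))) := by
  sorry

/-- **stub B — ACTIVE in-band collisional-transfer closure.** Same frame for the REMAINDER
`energyDefect − kineticDefect` (collisional transfer of kinetic energy across contacts versus the
excess-pressure work `(p − ρθ)(m/ρ)·∇φ`, `p = hsPressure σ ρ θ`): in a dilute FLUID band the contact
configurations refresh every collision time and the local virial equals the equation of state at ball scale, so a
sustained anomalous contact value costs collision-count entropy `≍ N^(4/3)`; collisional heat flux `≍ N^(-1/12)`.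
Why it might fail: ordered contact textures below the packing cap biasing the transfer direction for `O(1)`
times at `O(N)` cost (none known in the fluid band); the `deriv`/`limsup` branch of `hsPressure`'s virial factor
off the analyticity radius (choose `η₁` inside it). -/
theorem stub_activeCollisionalClosure :
    ∃ η₁ : ℝ, 0 < η₁ ∧ ∃ σ₀ : ℝ, 0 < σ₀ ∧ ∀ σ : ℝ, 0 < σ → σ < σ₀ → ∀ θe : ℝ, 0 < θe →
      ∀ Φ : (N : ℕ) → Flow σ N, ∀ (s τ : ℝ), 0 ≤ s → 0 < τ → ∀ φ : ℝ → T3 → ℝ,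
        Literature.Analysis.FunctionSpaces.Torus.IsSmoothSpaceTimeOn (Set.Icc s (s + τ)) φ →
          ∀ δ : ℝ, 0 < δ → ∃ α κ : ℝ, 0 < α ∧ 0 < κ ∧ κ < 1 ∧ ∀ M : ℝ, ∀ᶠ N : ℕ in Filter.atTop,
            localGibbsLaw σ (fun _ => 1) (fun _ => 0) (fun _ => θe) N (Φ N)
                {z | SpeedCap σ N (Φ N) s τ z ∧ PackingCap σ η₁ N (Φ N) s τ z ∧
                  δ < |energyDefect σ N (Φ N) s τ φ z - kineticDefect σ N (Φ N) s τ φ z| ∧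
                  ¬ deficitPred σ N (Φ N) s τ α κ z}
              ≤ ENNReal.ofReal (Real.exp (-(M * (N + 1)))) := by
  sorry

/-! ### Glue lemmas (sorry-free) -/

theorem PackingCap.mono {σ η η' : ℝ} {N : ℕ} {Φ : Flow σ N} {s τ : ℝ}
    {z : Literature.Analysis.FluidPDE.Config (N + 1) (Fin 3) T3}
    (h : η ≤ η') (hp : PackingCap σ η N Φ s τ z) : PackingCap σ η' N Φ s τ z := by
  unfold PackingCap at hp ⊢
  intro r hr x
  exact (hp r hr x).trans h

/-- `Deficit_(α,κ)` is antitone in `(α, κ)` (`pred ≥ 0` since `τ > 0`). -/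
theorem deficitPred_mono {σ : ℝ} {N : ℕ} {Φ : Flow σ N} {s τ α α' κ κ' : ℝ}
    (hτ : 0 < τ) (hα : α ≤ α') (hκ : κ ≤ κ')
    (z : Literature.Analysis.FluidPDE.Config (N + 1) (Fin 3) T3)
    (h : deficitPred σ N Φ s τ α' κ' z) : deficitPred σ N Φ s τ α κ z := by
  dsimp only [deficitPred] at h ⊢
  refine le_trans (ENNReal.ofReal_le_ofReal hα) (le_trans h (lintegral_mono_set ?_))
  intro x hx
  simp only [Set.mem_setOf_eq] at hx ⊢
  refine le_trans hx (mul_le_mul_of_nonneg_right (by linarith) ?_)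
  refine mul_nonneg (by positivity) ?_
  refine intervalIntegral.integral_nonneg (by linarith) (fun r _ => ?_)
  exact mul_nonneg (sq_nonneg _) (Real.sqrt_nonneg _)

theorem abs_half_split (D I δ : ℝ) (h : δ < |D|) : δ / 2 < |D - I| ∨ δ / 2 < |I| := by
  by_cases hI : δ / 2 < |I|
  · exact Or.inr hI
  · left
    have hI' : |I| ≤ δ / 2 := not_lt.mp hI
    have h1 : |D| - |I| ≤ |D - I| := abs_sub_abs_le_abs_sub D I
    linarith

theorem two_mul_exp_neg_le_one (N : ℕ) : 2 * Real.exp (-((N : ℝ) + 1)) ≤ 1 := by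
  have hge : (2 : ℝ) ≤ Real.exp ((N : ℝ) + 1) := by
    have h := Real.add_one_le_exp ((N : ℝ) + 1)
    have hN : (0 : ℝ) ≤ N := Nat.cast_nonneg N
    linarith
  have hmul : Real.exp ((N : ℝ) + 1) * Real.exp (-((N : ℝ) + 1)) = 1 := by
    rw [← Real.exp_add, add_neg_cancel, Real.exp_zero]
  have hpos : 0 < Real.exp (-((N : ℝ) + 1)) := Real.exp_pos _
  nlinarith

theorem two_half_budget (M : ℝ) (N : ℕ) :
    ENNReal.ofReal (Real.exp (-((M + 1) * ((N : ℝ) + 1)))) +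
        ENNReal.ofReal (Real.exp (-((M + 1) * ((N : ℝ) + 1)))) ≤
      ENNReal.ofReal (Real.exp (-(M * ((N : ℝ) + 1)))) := by
  have hA : 0 < Real.exp (-(M * ((N : ℝ) + 1))) := Real.exp_pos _
  have hexp : Real.exp (-((M + 1) * ((N : ℝ) + 1))) =
      Real.exp (-(M * ((N : ℝ) + 1))) * Real.exp (-((N : ℝ) + 1)) := by
    rw [← Real.exp_add]
    congr 1
    ring
  have hreal : Real.exp (-((M + 1) * ((N : ℝ) + 1))) + Real.exp (-((M + 1) * ((N : ℝ) + 1))) ≤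
      Real.exp (-(M * ((N : ℝ) + 1))) := by
    rw [hexp]
    calc Real.exp (-(M * ((N : ℝ) + 1))) * Real.exp (-((N : ℝ) + 1)) +
          Real.exp (-(M * ((N : ℝ) + 1))) * Real.exp (-((N : ℝ) + 1))
        = Real.exp (-(M * ((N : ℝ) + 1))) * (2 * Real.exp (-((N : ℝ) + 1))) := by ring
      _ ≤ Real.exp (-(M * ((N : ℝ) + 1))) * 1 :=
          mul_le_mul_of_nonneg_left (two_mul_exp_neg_le_one N) hA.le
      _ = Real.exp (-(M * ((N : ℝ) + 1))) := mul_one _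
  calc ENNReal.ofReal (Real.exp (-((M + 1) * ((N : ℝ) + 1)))) +
        ENNReal.ofReal (Real.exp (-((M + 1) * ((N : ℝ) + 1))))
      = ENNReal.ofReal (Real.exp (-((M + 1) * ((N : ℝ) + 1))) +
          Real.exp (-((M + 1) * ((N : ℝ) + 1)))) :=
        (ENNReal.ofReal_add (Real.exp_pos _).le (Real.exp_pos _).le).symm
    _ ≤ ENNReal.ofReal (Real.exp (-(M * ((N : ℝ) + 1)))) := ENNReal.ofReal_le_ofReal hreal

/-- The crux event at packing `min η₁ η₂` and deficit pair `(min α₁ α₂, min κ₁ κ₂)` lies in the union of the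
two stub events at `δ/2`. -/
theorem defectEvent_subset_union (σ η₁ η₂ : ℝ) (N : ℕ) (Φ : Flow σ N) (s τ : ℝ) (hτ : 0 < τ)
    (φ : ℝ → T3 → ℝ) (δ α₁ α₂ κ₁ κ₂ : ℝ) :
    {z | SpeedCap σ N Φ s τ z ∧ PackingCap σ (min η₁ η₂) N Φ s τ z ∧
        δ < |energyDefect σ N Φ s τ φ z| ∧ ¬ deficitPred σ N Φ s τ (min α₁ α₂) (min κ₁ κ₂) z} ⊆
      {z | SpeedCap σ N Φ s τ z ∧ PackingCap σ η₂ N Φ s τ z ∧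
          δ / 2 < |energyDefect σ N Φ s τ φ z - kineticDefect σ N Φ s τ φ z| ∧
          ¬ deficitPred σ N Φ s τ α₂ κ₂ z} ∪
      {z | SpeedCap σ N Φ s τ z ∧ PackingCap σ η₁ N Φ s τ z ∧
          δ / 2 < |kineticDefect σ N Φ s τ φ z| ∧ ¬ deficitPred σ N Φ s τ α₁ κ₁ z} := by
  rintro z ⟨hv, hp, hd, hnd⟩
  rcases abs_half_split (energyDefect σ N Φ s τ φ z) (kineticDefect σ N Φ s τ φ z) δ hd with h | h
  · exact Or.inl ⟨hv, hp.mono (min_le_right _ _), h,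
      fun h' => hnd (deficitPred_mono hτ (min_le_right _ _) (min_le_right _ _) z h')⟩
  · exact Or.inr ⟨hv, hp.mono (min_le_left _ _), h,
      fun h' => hnd (deficitPred_mono hτ (min_le_left _ _) (min_le_left _ _) z h')⟩

/-! ### The assembly: the two stubs imply the crux BY NAME -/

/-- Hypothesis form of the composition (sorry-free; `#print axioms` clean). -/
theorem InBandActiveEnergyClosureCost_of_stubs
    (hK : ∃ η₁ : ℝ, 0 < η₁ ∧ ∃ σ₀ : ℝ, 0 < σ₀ ∧ ∀ σ : ℝ, 0 < σ → σ < σ₀ → ∀ θe : ℝ, 0 < θe →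
      ∀ Φ : (N : ℕ) → Flow σ N, ∀ (s τ : ℝ), 0 ≤ s → 0 < τ → ∀ φ : ℝ → T3 → ℝ,
        Literature.Analysis.FunctionSpaces.Torus.IsSmoothSpaceTimeOn (Set.Icc s (s + τ)) φ →
          ∀ δ : ℝ, 0 < δ → ∃ α κ : ℝ, 0 < α ∧ 0 < κ ∧ κ < 1 ∧ ∀ M : ℝ, ∀ᶠ N : ℕ in Filter.atTop,
            localGibbsLaw σ (fun _ => 1) (fun _ => 0) (fun _ => θe) N (Φ N)
                {z | SpeedCap σ N (Φ N) s τ z ∧ PackingCap σ η₁ N (Φ N) s τ z ∧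
                  δ < |kineticDefect σ N (Φ N) s τ φ z| ∧ ¬ deficitPred σ N (Φ N) s τ α κ z}
              ≤ ENNReal.ofReal (Real.exp (-(M * (N + 1)))))
    (hC : ∃ η₁ : ℝ, 0 < η₁ ∧ ∃ σ₀ : ℝ, 0 < σ₀ ∧ ∀ σ : ℝ, 0 < σ → σ < σ₀ → ∀ θe : ℝ, 0 < θe →
      ∀ Φ : (N : ℕ) → Flow σ N, ∀ (s τ : ℝ), 0 ≤ s → 0 < τ → ∀ φ : ℝ → T3 → ℝ,
        Literature.Analysis.FunctionSpaces.Torus.IsSmoothSpaceTimeOn (Set.Icc s (s + τ)) φ →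
          ∀ δ : ℝ, 0 < δ → ∃ α κ : ℝ, 0 < α ∧ 0 < κ ∧ κ < 1 ∧ ∀ M : ℝ, ∀ᶠ N : ℕ in Filter.atTop,
            localGibbsLaw σ (fun _ => 1) (fun _ => 0) (fun _ => θe) N (Φ N)
                {z | SpeedCap σ N (Φ N) s τ z ∧ PackingCap σ η₁ N (Φ N) s τ z ∧
                  δ < |energyDefect σ N (Φ N) s τ φ z - kineticDefect σ N (Φ N) s τ φ z| ∧
                  ¬ deficitPred σ N (Φ N) s τ α κ z}
              ≤ ENNReal.ofReal (Real.exp (-(M * (N + 1))))) :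
    CruxStatement := by
  show Summit.AtomisticToContinuum.HydrodynamicLimit.Theses.SinaiSteeringDichotomy.InBandActiveEnergyClosureCost
  obtain ⟨η₁, hη₁, σ₁, hσ₁, H₁⟩ := hK
  obtain ⟨η₂, hη₂, σ₂, hσ₂, H₂⟩ := hC
  refine ⟨min η₁ η₂, lt_min hη₁ hη₂, min σ₁ σ₂, lt_min hσ₁ hσ₂, ?_⟩
  intro σ hσ hσlt θe hθe Φ s τ hs hτ φ hφ δ hδ
  obtain ⟨α₁, κ₁, hα₁, hκ₁, hκ₁', G₁⟩ :=
    H₁ σ hσ (lt_of_lt_of_le hσlt (min_le_left _ _)) θe hθe Φ s τ hs hτ φ hφ (δ / 2) (half_pos hδ)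
  obtain ⟨α₂, κ₂, hα₂, hκ₂, hκ₂', G₂⟩ :=
    H₂ σ hσ (lt_of_lt_of_le hσlt (min_le_right _ _)) θe hθe Φ s τ hs hτ φ hφ (δ / 2) (half_pos hδ)
  refine ⟨min α₁ α₂, min κ₁ κ₂, lt_min hα₁ hα₂, lt_min hκ₁ hκ₂,
    lt_of_le_of_lt (min_le_left _ _) hκ₁', fun M => ?_⟩
  filter_upwards [G₁ (M + 1), G₂ (M + 1)] with N hN₁ hN₂
  change localGibbsLaw σ (fun _ => 1) (fun _ => 0) (fun _ => θe) N (Φ N)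
      {z | SpeedCap σ N (Φ N) s τ z ∧ PackingCap σ (min η₁ η₂) N (Φ N) s τ z ∧
        δ < |energyDefect σ N (Φ N) s τ φ z| ∧
        ¬ deficitPred σ N (Φ N) s τ (min α₁ α₂) (min κ₁ κ₂) z} ≤ ENNReal.ofReal (Real.exp (-(M * (N + 1))))
  calc localGibbsLaw σ (fun _ => 1) (fun _ => 0) (fun _ => θe) N (Φ N)
        {z | SpeedCap σ N (Φ N) s τ z ∧ PackingCap σ (min η₁ η₂) N (Φ N) s τ z ∧
          δ < |energyDefect σ N (Φ N) s τ φ z| ∧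
          ¬ deficitPred σ N (Φ N) s τ (min α₁ α₂) (min κ₁ κ₂) z}
      ≤ localGibbsLaw σ (fun _ => 1) (fun _ => 0) (fun _ => θe) N (Φ N)
          ({z | SpeedCap σ N (Φ N) s τ z ∧ PackingCap σ η₂ N (Φ N) s τ z ∧
              δ / 2 < |energyDefect σ N (Φ N) s τ φ z - kineticDefect σ N (Φ N) s τ φ z| ∧
              ¬ deficitPred σ N (Φ N) s τ α₂ κ₂ z} ∪
            {z | SpeedCap σ N (Φ N) s τ z ∧ PackingCap σ η₁ N (Φ N) s τ z ∧
              δ / 2 < |kineticDefect σ N (Φ N) s τ φ z| ∧ ¬ deficitPred σ N (Φ N) s τ α₁ κ₁ z}) :=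
        measure_mono (defectEvent_subset_union σ η₁ η₂ N (Φ N) s τ hτ φ δ α₁ α₂ κ₁ κ₂)
    _ ≤ localGibbsLaw σ (fun _ => 1) (fun _ => 0) (fun _ => θe) N (Φ N)
            {z | SpeedCap σ N (Φ N) s τ z ∧ PackingCap σ η₂ N (Φ N) s τ z ∧
              δ / 2 < |energyDefect σ N (Φ N) s τ φ z - kineticDefect σ N (Φ N) s τ φ z| ∧
              ¬ deficitPred σ N (Φ N) s τ α₂ κ₂ z} +
          localGibbsLaw σ (fun _ => 1) (fun _ => 0) (fun _ => θe) N (Φ N)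
            {z | SpeedCap σ N (Φ N) s τ z ∧ PackingCap σ η₁ N (Φ N) s τ z ∧
              δ / 2 < |kineticDefect σ N (Φ N) s τ φ z| ∧ ¬ deficitPred σ N (Φ N) s τ α₁ κ₁ z} :=
        measure_union_le _ _
    _ ≤ ENNReal.ofReal (Real.exp (-((M + 1) * ((N : ℝ) + 1)))) +
          ENNReal.ofReal (Real.exp (-((M + 1) * ((N : ℝ) + 1)))) := add_le_add hN₂ hN₁
    _ ≤ ENNReal.ofReal (Real.exp (-(M * ((N : ℝ) + 1)))) := two_half_budget M N

/-- **Assembly (the skeleton theorem).** The crux BY NAME from the two DECLARED stubs (the only `sorry`s of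
the file). -/
theorem InBandActiveEnergyClosureCost_of : Summit.AtomisticToContinuum.HydrodynamicLimit.Theses.SinaiSteeringDichotomy.InBandActiveEnergyClosureCost :=
  InBandActiveEnergyClosureCost_of_stubs stub_activeKineticClosure stub_activeCollisionalClosure

end

end Summit.AtomisticToContinuum.HydrodynamicLimit.Cruxes.ActiveEnergyClosureCost.InBandBirth
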